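import Mathlib
import Literature.Analysis.Matrix.KatoSemisimpleFirstOrder
import HarnessLib

/-!
# Proof of `Kato1966_II_thm_2_3` (first-order splitting at a semisimple eigenvalue)

Discharges the named fact `Literature.Analysis.Matrix.Kato1966_II_thm_2_3` of
`Literature/Analysis/Matrix/KatoSemisimpleFirstOrder.lean` (T. Kato, *Perturbation Theory for
Linear Operators* (1966), Ch. II §2.3, Theorem 2.3 — the existence-to-first-order corollary for an
affine matrix family `T + κ T₁` that the tree vendors).

## The argument formalised here (elementary; no analytic perturbation theory)

Write `E = ℂⁿ = M ⊕ N`, `M = ker (T - λ)`, `N = range (T - λ)` (the semisimplicity hypothesis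
`IsCompl M N`) and pick bases of `M` and `N`.  In the adapted basis `T - λ = [[0, 0], [0, S]]`
with `S = (T - λ)|_N` invertible, and `T₁ = [[A, B], [C, D]]` with `A` the matrix of Kato's
compression `P T₁|_M` (`toMatrix_map_prod_eq_fromBlocks`).  Hence for every `κ, z`

`det (T + κ T₁ - (λ + κ z)) = κ^m · Q(κ, z)`, `Q(κ, z) := det [[A - z, B], [κ C, S + κ (D - z)]]`,

with `Q` polynomial in `κ` and `Q(0, z) = det (A - z) · det S` (`det_factorisation`).  If `μ` is
an eigenvalue of the compression then `Q(0, μ) = 0`, while `Q(0, z₁) ≠ 0` for some `z₁`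
arbitrarily close to `μ` (finitely many eigenvalues).  By continuity in `κ`, for small `κ ≠ 0`
the value `|det (T + κT₁ - (λ + κ z₁))|` exceeds `(3/2)ⁿ |det (T + κT₁ - (λ + κ μ))|`; since the
characteristic polynomial splits over `ℂ`, the elementary root-proximity lemma
`exists_mem_norm_sub_le_of_prod_lt` then yields an eigenvalue within `ε |κ|` of `λ + κ μ`
(`Kato1966_II_thm_2_3_holds`).
-/

noncomputable section

namespace Literature.Analysis.Matrix

open Module Module.End Polynomial

/-- Root-proximity lemma for split polynomials, multiset form: if `|∏_{r ∈ s} (w₁ - r)|` strictly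
exceeds `(3/2)^{card s} · |∏_{r ∈ s} (w₀ - r)|` at a point `w₁` with `|w₁ - w₀| ≤ ρ / 2`, then some
`r ∈ s` lies within `ρ` of `w₀` (otherwise `|w₁ - r| ≤ (3/2) |w₀ - r|` for every `r`). [folklore] -/
theorem exists_mem_norm_sub_le_of_prod_lt {s : Multiset ℂ} {w₀ w₁ : ℂ} {ρ : ℝ}
    (hw : ‖w₁ - w₀‖ ≤ ρ / 2)
    (h : (3 / 2 : ℝ) ^ Multiset.card s * ‖(s.map (w₀ - ·)).prod‖ < ‖(s.map (w₁ - ·)).prod‖) :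
    ∃ r ∈ s, ‖r - w₀‖ ≤ ρ := by
  by_contra hcon
  push Not at hcon
  -- every root is farther than `ρ` from `w₀`; then the product at `w₁` is controlled
  have key : ‖(s.map (w₁ - ·)).prod‖ ≤
      (3 / 2 : ℝ) ^ Multiset.card s * ‖(s.map (w₀ - ·)).prod‖ := by
    clear h
    induction s using Multiset.induction_on with
    | empty => simp
    | cons a s ih =>
      have ha : ρ < ‖a - w₀‖ := hcon a (Multiset.mem_cons_self a s)
      have ih' := ih (fun r hr => hcon r (Multiset.mem_cons_of_mem hr))
      simp only [Multiset.map_cons, Multiset.prod_cons, Multiset.card_cons, norm_mul, pow_succ]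
      have h1 : ‖w₁ - a‖ ≤ (3 / 2 : ℝ) * ‖w₀ - a‖ := by
        have hρ : ρ < ‖w₀ - a‖ := by rwa [norm_sub_rev] at ha
        calc ‖w₁ - a‖ = ‖(w₁ - w₀) + (w₀ - a)‖ := by ring_nf
          _ ≤ ‖w₁ - w₀‖ + ‖w₀ - a‖ := norm_add_le _ _
          _ ≤ ρ / 2 + ‖w₀ - a‖ := by linarith
          _ ≤ (3 / 2 : ℝ) * ‖w₀ - a‖ := by linarith
      calc ‖w₁ - a‖ * ‖(Multiset.map (fun x => w₁ - x) s).prod‖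
          ≤ ((3 / 2 : ℝ) * ‖w₀ - a‖) *
              ((3 / 2 : ℝ) ^ Multiset.card s * ‖(Multiset.map (fun x => w₀ - x) s).prod‖) :=
            mul_le_mul h1 ih' (norm_nonneg _) (by positivity)
        _ = (3 / 2 : ℝ) ^ Multiset.card s * (3 / 2) *
              (‖w₀ - a‖ * ‖(Multiset.map (fun x => w₀ - x) s).prod‖) := by ring
  exact absurd h (not_lt.mpr key)

/-- Block form of an endomorphism in a basis adapted to a complementary pair `E = p ⊕ q`:
the matrix of `g` in the basis `(bp, bq)` (transported along `p × q ≃ E`) is the block matrix of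
the four compressions `P_p g|_p`, `P_p g|_q`, `P_q g|_p`, `P_q g|_q` (projections ALONG the
complement, i.e. Kato's eigenprojections when `p, q` are the spectral subspaces). [folklore] -/
theorem toMatrix_map_prod_eq_fromBlocks {E : Type*} [AddCommGroup E] [Module ℂ E]
    (p q : Submodule ℂ E) (hc : IsCompl p q) {ι ι' : Type*} [Fintype ι] [Fintype ι']
    [DecidableEq ι] [DecidableEq ι']
    (bp : Basis ι ℂ p) (bq : Basis ι' ℂ q) (g : E →ₗ[ℂ] E) :
    LinearMap.toMatrix ((bp.prod bq).map (p.prodEquivOfIsCompl q hc))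
        ((bp.prod bq).map (p.prodEquivOfIsCompl q hc)) g =
      Matrix.fromBlocks
        (LinearMap.toMatrix bp bp (p.projectionOnto q hc ∘ₗ g ∘ₗ p.subtype))
        (LinearMap.toMatrix bq bp (p.projectionOnto q hc ∘ₗ g ∘ₗ q.subtype))
        (LinearMap.toMatrix bp bq (q.projectionOnto p hc.symm ∘ₗ g ∘ₗ p.subtype))
        (LinearMap.toMatrix bq bq (q.projectionOnto p hc.symm ∘ₗ g ∘ₗ q.subtype)) := by
  ext i j
  rcases i with i | i <;> rcases j with j | j <;>
    simp [LinearMap.toMatrix_apply, Submodule.prodEquivOfIsCompl_symm_apply]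

/-- Entrywise continuity of `κ ↦ κ • C` for a fixed complex matrix `C`. [folklore] -/
theorem continuous_smul_const_matrix {l m : Type*} (C : Matrix l m ℂ) :
    Continuous fun κ : ℂ => κ • C := by
  refine continuous_pi fun i => continuous_pi fun j => ?_
  simp only [Matrix.smul_apply, smul_eq_mul]
  exact continuous_id.mul continuous_const

/-- **The block factorisation** (the `κ = 0` end of Kato's reduction process, II-§2.3, done with
determinants).  For endomorphisms `f, t₁` of a finite-dimensional complex space with
`ker f ⊕ range f = E` (i.e. `0` is a semisimple eigenvalue of `f`) and an eigenvalue `μ` of the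
compression `P t₁|_{ker f}` (projection along `range f`), there are `m` (`= dim ker f`) and a
function `Q(κ, z)`, continuous in `κ`, with
`det (f + κ (t₁ - z)) = κ^m · Q(κ, z)` for all `κ, z`, `Q(0, μ) = 0`, and `Q(0, z₁) ≠ 0` for
points `z₁` arbitrarily close to `μ`. [cite: Kato1966, II-§2.3 (2.37)–(2.40)] -/
theorem det_factorisation {E : Type*} [AddCommGroup E] [Module ℂ E] [FiniteDimensional ℂ E]
    (f t₁ : E →ₗ[ℂ] E) (hc : IsCompl (LinearMap.ker f) (LinearMap.range f)) (μ : ℂ)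
    (hμ : HasEigenvalue ((LinearMap.ker f).projectionOnto (LinearMap.range f) hc ∘ₗ
      (t₁ ∘ₗ (LinearMap.ker f).subtype)) μ) :
    ∃ (m : ℕ) (Q : ℂ → ℂ → ℂ),
      (∀ κ z : ℂ, LinearMap.det (f + κ • (t₁ - z • LinearMap.id)) = κ ^ m * Q κ z) ∧
      (∀ z : ℂ, Continuous fun κ : ℂ => Q κ z) ∧ Q 0 μ = 0 ∧
      ∀ η : ℝ, 0 < η → ∃ z₁ : ℂ, ‖z₁ - μ‖ < η ∧ Q 0 z₁ ≠ 0 := by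
  -- the two complementary subspaces and the projections along each other
  set Kr : Submodule ℂ E := LinearMap.ker f with hKr
  set Rg : Submodule ℂ E := LinearMap.range f with hRg
  set P : E →ₗ[ℂ] Kr := Kr.projectionOnto Rg hc with hP
  set PR : E →ₗ[ℂ] Rg := Rg.projectionOnto Kr hc.symm with hPR
  set Cc : Kr →ₗ[ℂ] Kr := P ∘ₗ (t₁ ∘ₗ Kr.subtype) with hCc
  set BK : Rg →ₗ[ℂ] Kr := P ∘ₗ (t₁ ∘ₗ Rg.subtype) with hBK
  set CK : Kr →ₗ[ℂ] Rg := PR ∘ₗ (t₁ ∘ₗ Kr.subtype) with hCK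
  set DR : Rg →ₗ[ℂ] Rg := PR ∘ₗ (t₁ ∘ₗ Rg.subtype) with hDR
  have hfR : ∀ x ∈ Rg, f x ∈ Rg := fun x _ => LinearMap.mem_range_self f x
  set fR : Rg →ₗ[ℂ] Rg := f.restrict hfR with hfRdef
  -- elementary facts about the projections
  have hfK : ∀ x : Kr, f x = 0 := fun x => LinearMap.mem_ker.mp x.2
  have hPK : ∀ x : Kr, P x = x := fun x => Submodule.projectionOnto_apply_left hc x
  have hPR0 : ∀ x : Rg, P x = 0 := fun x => Submodule.projectionOnto_apply_right hc x
  have hPRK0 : ∀ x : Kr, PR x = 0 := fun x => Submodule.projectionOnto_apply_right hc.symm x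
  have hPRR : ∀ x : Rg, PR x = x := fun x => Submodule.projectionOnto_apply_left hc.symm x
  have hPf : ∀ x : E, P (f x) = 0 := fun x =>
    (Submodule.projectionOnto_apply_eq_zero_iff hc).mpr (LinearMap.mem_range_self f x)
  have hPRf : ∀ x : Rg, PR (f x) = fR x := fun x => by
    rw [Submodule.projectionOnto_apply_of_mem_left hc.symm (LinearMap.mem_range_self f _)]
    rfl
  -- the four compressions of `g κ z := f + κ • (t₁ - z • id)`
  have hKK : ∀ κ z : ℂ, P ∘ₗ (f + κ • (t₁ - z • LinearMap.id)) ∘ₗ Kr.subtype =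
      κ • (Cc - z • LinearMap.id) := fun κ z => by
    refine LinearMap.ext fun x => ?_
    simp [hCc, hfK, hPK, smul_sub]
  have hRK : ∀ κ z : ℂ, P ∘ₗ (f + κ • (t₁ - z • LinearMap.id)) ∘ₗ Rg.subtype = κ • BK :=
    fun κ z => by
    refine LinearMap.ext fun x => ?_
    simp [hBK, hPf, hPR0, smul_sub]
  have hKR : ∀ κ z : ℂ, PR ∘ₗ (f + κ • (t₁ - z • LinearMap.id)) ∘ₗ Kr.subtype = κ • CK :=
    fun κ z => by
    refine LinearMap.ext fun x => ?_
    simp [hCK, hfK, hPRK0, smul_sub]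
  have hRR : ∀ κ z : ℂ, PR ∘ₗ (f + κ • (t₁ - z • LinearMap.id)) ∘ₗ Rg.subtype =
      fR + κ • (DR - z • LinearMap.id) := fun κ z => by
    refine LinearMap.ext fun x => ?_
    simp [hDR, hPRf, hPRR, smul_sub]
  -- bases
  let bK := Module.finBasis ℂ Kr
  let bR := Module.finBasis ℂ Rg
  let b := (bK.prod bR).map (Kr.prodEquivOfIsCompl Rg hc)
  -- the function `Q`
  refine ⟨finrank ℂ Kr, fun κ z =>
    (Matrix.fromBlocks (LinearMap.toMatrix bK bK (Cc - z • LinearMap.id))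
      (LinearMap.toMatrix bR bK BK) (κ • LinearMap.toMatrix bK bR CK)
      (LinearMap.toMatrix bR bR fR + κ • LinearMap.toMatrix bR bR (DR - z • LinearMap.id))).det,
    ?_, ?_, ?_, ?_⟩
  · -- (C1) factorisation
    intro κ z
    rw [← LinearMap.det_toMatrix b, toMatrix_map_prod_eq_fromBlocks, hKK, hRK, hKR, hRR]
    simp only [map_smul, map_add]
    have hfac : Matrix.fromBlocks (κ • LinearMap.toMatrix bK bK (Cc - z • LinearMap.id))
        (κ • LinearMap.toMatrix bR bK BK) (κ • LinearMap.toMatrix bK bR CK)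
        (LinearMap.toMatrix bR bR fR + κ • LinearMap.toMatrix bR bR (DR - z • LinearMap.id)) =
        Matrix.fromBlocks (κ • (1 : Matrix (Fin (finrank ℂ Kr)) (Fin (finrank ℂ Kr)) ℂ)) 0 0 1 *
          Matrix.fromBlocks (LinearMap.toMatrix bK bK (Cc - z • LinearMap.id))
            (LinearMap.toMatrix bR bK BK) (κ • LinearMap.toMatrix bK bR CK)
            (LinearMap.toMatrix bR bR fR +
              κ • LinearMap.toMatrix bR bR (DR - z • LinearMap.id)) := by
      rw [Matrix.fromBlocks_multiply]
      simp
    rw [hfac, Matrix.det_mul, Matrix.det_fromBlocks_zero₂₁, Matrix.det_one, mul_one,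
      Matrix.det_smul, Matrix.det_one, mul_one, Fintype.card_fin]
  · -- (C2) continuity in κ
    intro z
    refine Continuous.matrix_det ?_
    refine Continuous.matrix_fromBlocks continuous_const continuous_const
      (continuous_smul_const_matrix _) ?_
    exact continuous_const.add (continuous_smul_const_matrix _)
  · -- (C3) `Q 0 μ = 0`
    simp only [zero_smul, add_zero]
    rw [Matrix.det_fromBlocks_zero₂₁, LinearMap.det_toMatrix, mul_eq_zero]
    left
    rw [LinearMap.det_eq_zero_iff_ker_ne_bot]
    have := hμ
    rw [Module.End.hasEigenvalue_iff] at this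
    simpa [Module.End.eigenspace_def, Module.End.one_eq_id] using this
  · -- (C4) `Q 0 z₁ ≠ 0` near `μ`
    intro η hη
    have hSdet : (LinearMap.toMatrix bR bR fR).det ≠ 0 := by
      rw [LinearMap.det_toMatrix]
      intro h0
      rw [LinearMap.det_eq_zero_iff_ker_ne_bot] at h0
      apply h0
      rw [LinearMap.ker_eq_bot']
      intro x hx
      have hx0 : f x = 0 := by
        have := congrArg Subtype.val hx
        simpa [hfRdef, LinearMap.restrict_apply] using this
      have hxK : (x : E) ∈ Kr := LinearMap.mem_ker.mpr hx0
      exact Subtype.ext (Submodule.disjoint_def.mp hc.disjoint _ hxK x.2)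
    have hfin : Set.Finite {z : ℂ | HasEigenvalue Cc z} := by
      have : {z : ℂ | HasEigenvalue Cc z} = {z : ℂ | Cc.charpoly.IsRoot z} := by
        ext z
        exact Module.End.hasEigenvalue_iff_isRoot_charpoly Cc z
      rw [this]
      exact Polynomial.finite_setOf_isRoot (LinearMap.charpoly_monic Cc).ne_zero
    have hdense : Dense ({z : ℂ | HasEigenvalue Cc z}ᶜ) := hfin.countable.dense_compl ℂ
    obtain ⟨z₁, hz₁c, hz₁b⟩ := hdense.exists_mem_open Metric.isOpen_ball
      ⟨μ, Metric.mem_ball_self hη⟩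
    refine ⟨z₁, by simpa [dist_eq_norm] using hz₁b, ?_⟩
    simp only [zero_smul, add_zero]
    rw [Matrix.det_fromBlocks_zero₂₁]
    refine mul_ne_zero ?_ hSdet
    rw [LinearMap.det_toMatrix]
    intro h0
    rw [LinearMap.det_eq_zero_iff_ker_ne_bot] at h0
    apply hz₁c
    show HasEigenvalue Cc z₁
    rw [Module.End.hasEigenvalue_iff]
    simpa [Module.End.eigenspace_def, Module.End.one_eq_id] using h0

/-- **Kato 1966, Theorem II-2.3 (existence to first order), proved.**  Discharges the named fact
`Kato1966_II_thm_2_3` for every pair of complex matrices `T, T₁` and every `λ`: if `λ` is a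
semisimple eigenvalue of `T` (`ker (T-λ) ⊕ range (T-λ) = ℂⁿ`) and `μ` is an eigenvalue of the
compression of `T₁` to `ker (T-λ)` along `range (T-λ)`, then for every `ε > 0` there is `δ > 0`
such that for `|κ| < δ` the matrix `T + κ T₁` has an eigenvalue `ν` with `|ν - λ - κ μ| ≤ ε |κ|`.
The proof is the block-determinant / root-proximity argument of the module docstring (no
analytic function theory is used). [cite: Kato1966, Thm II-2.3] -/
theorem Kato1966_II_thm_2_3_holds :
    ∀ {n : Type*} [Fintype n] [DecidableEq n] (T T₁ : Matrix n n ℂ) (lam : ℂ),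
      Kato1966_II_thm_2_3 T T₁ lam := by
  intro n _ _ T T₁ lam hc μ hμ ε hε
  set f : (n → ℂ) →ₗ[ℂ] (n → ℂ) := Matrix.toLin' (T - lam • (1 : Matrix n n ℂ)) with hfdef
  set t₁ : (n → ℂ) →ₗ[ℂ] (n → ℂ) := Matrix.toLin' T₁ with ht₁
  obtain ⟨m, Q, hdet, hQc, hQμ, hz⟩ := det_factorisation f t₁ hc μ hμ
  obtain ⟨z₁, hz₁μ, hQz₁⟩ := hz (ε / 2) (half_pos hε)
  -- (C1) at matrix level
  have hC1 : ∀ κ z : ℂ,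
      (T + κ • T₁ - (lam + κ * z) • (1 : Matrix n n ℂ)).det = κ ^ m * Q κ z := by
    intro κ z
    have hlin : Matrix.toLin' (T + κ • T₁ - (lam + κ * z) • (1 : Matrix n n ℂ)) =
        f + κ • (t₁ - z • LinearMap.id) := by
      simp only [hfdef, ht₁, map_sub, map_add, map_smul, Matrix.toLin'_one]
      module
    rw [← LinearMap.det_toLin', hlin, hdet]
  -- choice of δ
  set c : ℝ := ‖Q 0 z₁‖ with hcdef
  have hc0 : 0 < c := norm_pos_iff.mpr hQz₁
  set K₀ : ℝ := (3 / 2 : ℝ) ^ Fintype.card n with hK₀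
  have hK₀0 : 0 < K₀ := by positivity
  obtain ⟨δ₁, hδ₁, hδ₁Q⟩ : ∃ δ₁ > 0, ∀ κ : ℂ, ‖κ‖ < δ₁ → c / 2 < ‖Q κ z₁‖ := by
    have hca : ContinuousAt (fun κ : ℂ => Q κ z₁) 0 := (hQc z₁).continuousAt
    rw [Metric.continuousAt_iff] at hca
    obtain ⟨δ₁, hδ₁, h⟩ := hca (c / 2) (half_pos hc0)
    refine ⟨δ₁, hδ₁, fun κ hκ => ?_⟩
    have := h (by simpa using hκ)
    rw [dist_eq_norm] at this
    have htri : ‖Q 0 z₁‖ ≤ ‖Q κ z₁‖ + ‖Q κ z₁ - Q 0 z₁‖ := by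
      calc ‖Q 0 z₁‖ = ‖Q κ z₁ - (Q κ z₁ - Q 0 z₁)‖ := by ring_nf
        _ ≤ ‖Q κ z₁‖ + ‖Q κ z₁ - Q 0 z₁‖ := norm_sub_le _ _
    linarith
  obtain ⟨δ₂, hδ₂, hδ₂Q⟩ : ∃ δ₂ > 0, ∀ κ : ℂ, ‖κ‖ < δ₂ → K₀ * ‖Q κ μ‖ < c / 2 := by
    have hca : ContinuousAt (fun κ : ℂ => Q κ μ) 0 := (hQc μ).continuousAt
    rw [Metric.continuousAt_iff] at hca
    obtain ⟨δ₂, hδ₂, h⟩ := hca (c / 2 / K₀) (by positivity)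
    refine ⟨δ₂, hδ₂, fun κ hκ => ?_⟩
    have := h (by simpa using hκ)
    rw [dist_eq_norm, hQμ, sub_zero] at this
    calc K₀ * ‖Q κ μ‖ < K₀ * (c / 2 / K₀) := mul_lt_mul_of_pos_left this hK₀0
      _ = c / 2 := by field_simp
  refine ⟨min δ₁ δ₂, lt_min hδ₁ hδ₂, fun κ hκ => ?_⟩
  have hκ₁ : ‖κ‖ < δ₁ := lt_of_lt_of_le hκ (min_le_left _ _)
  have hκ₂ : ‖κ‖ < δ₂ := lt_of_lt_of_le hκ (min_le_right _ _)
  -- the case κ = 0 : `λ` itself is an eigenvalue of `T`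
  rcases eq_or_ne κ 0 with hκ0 | hκ0
  · subst hκ0
    refine ⟨lam, ?_, by simp⟩
    obtain ⟨v, hv⟩ := hμ.exists_hasEigenvector
    have hv0 : (v : n → ℂ) ≠ 0 := fun h => hv.2 (Subtype.ext h)
    have hvK : f v = 0 := LinearMap.mem_ker.mp v.2
    refine Module.End.hasEigenvalue_of_hasEigenvector (x := (v : n → ℂ)) ⟨?_, hv0⟩
    rw [Module.End.mem_eigenspace_iff]
    rw [hfdef] at hvK
    simp only [zero_smul, add_zero]
    simpa [sub_eq_zero, Matrix.sub_mulVec] using hvK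
  -- the case κ ≠ 0 : root proximity for the characteristic polynomial of `T + κ T₁`
  set M : Matrix n n ℂ := T + κ • T₁ with hM
  set p : Polynomial ℂ := M.charpoly with hp
  have hpmonic : p.Monic := Matrix.charpoly_monic M
  have hpsplit : p.Splits := IsAlgClosed.splits p
  have hp0 : p ≠ 0 := hpmonic.ne_zero
  set s : Multiset ℂ := p.roots with hs
  have hprod : ∀ w : ℂ, (s.map (w - ·)).prod = (Matrix.scalar n w - M).det := fun w => by
    rw [← Matrix.eval_charpoly, hs, hp, ← hpsplit.eval_eq_prod_roots_of_monic hpmonic]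
  have hnormdet : ∀ z : ℂ,
      ‖(Matrix.scalar n (lam + κ * z) - M).det‖ = ‖κ‖ ^ m * ‖Q κ z‖ := by
    intro z
    have h1 : Matrix.scalar n (lam + κ * z) - M = -(T + κ • T₁ - (lam + κ * z) • 1) := by
      simp [hM, Matrix.scalar_apply, Matrix.smul_one_eq_diagonal]
    rw [h1, Matrix.det_neg, hC1, norm_mul, norm_mul, norm_pow, norm_pow, norm_neg, norm_one,
      one_pow, one_mul]
  have hcard : Multiset.card s ≤ Fintype.card n := by
    calc Multiset.card s ≤ p.natDegree := Polynomial.card_roots' p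
      _ = Fintype.card n := Matrix.charpoly_natDegree_eq_dim M
  set w₀ : ℂ := lam + κ * μ with hw₀
  set w₁ : ℂ := lam + κ * z₁ with hw₁
  have hκpos : 0 < ‖κ‖ ^ m := pow_pos (norm_pos_iff.mpr hκ0) _
  have hw : ‖w₁ - w₀‖ ≤ ε * ‖κ‖ / 2 := by
    have : w₁ - w₀ = κ * (z₁ - μ) := by simp only [hw₀, hw₁]; ring
    rw [this, norm_mul]
    nlinarith [norm_nonneg κ, hz₁μ.le]
  have hlt : (3 / 2 : ℝ) ^ Multiset.card s * ‖(s.map (w₀ - ·)).prod‖ <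
      ‖(s.map (w₁ - ·)).prod‖ := by
    rw [hprod, hprod, hw₀, hw₁, hnormdet, hnormdet]
    have h3 : (3 / 2 : ℝ) ^ Multiset.card s ≤ K₀ := pow_le_pow_right₀ (by norm_num) hcard
    calc (3 / 2 : ℝ) ^ Multiset.card s * (‖κ‖ ^ m * ‖Q κ μ‖)
        ≤ K₀ * (‖κ‖ ^ m * ‖Q κ μ‖) := mul_le_mul_of_nonneg_right h3 (by positivity)
      _ = ‖κ‖ ^ m * (K₀ * ‖Q κ μ‖) := by ring
      _ < ‖κ‖ ^ m * (c / 2) := mul_lt_mul_of_pos_left (hδ₂Q κ hκ₂) hκpos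
      _ < ‖κ‖ ^ m * ‖Q κ z₁‖ := mul_lt_mul_of_pos_left (hδ₁Q κ hκ₁) hκpos
  obtain ⟨r, hr, hrw⟩ := exists_mem_norm_sub_le_of_prod_lt hw hlt
  refine ⟨r, ?_, by simpa [hw₀, sub_sub] using hrw⟩
  have hroot : p.IsRoot r := (Polynomial.mem_roots hp0).mp hr
  rw [Module.End.hasEigenvalue_iff_isRoot_charpoly, Matrix.charpoly_toLin']
  exact hroot

end Literature.Analysis.Matrix
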